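import Mathlib
import Summits.KontsevichZagierPeriods.KontsevichZagierPeriods.Theorems.TorsionLogsGKZLevelThreePairBetaCubic
import Summits.KontsevichZagierPeriods.KontsevichZagierPeriods.Theorems.TorsionLogsCertificateDlogUnfolds
import HarnessLib

/-!
# `BetaLinearSector` (stmt-KontsevichZagierPeriods-3897), line `fermat-sector-transport` —
# stub `stub_cubicArc_equivalent_thirdBeta` (the arc `(-1,0)` of `y² = x³ + 1` IS `B(1/3,1/2)`)

The LEVEL-6 rung (`a, b, a', b' ∈ ⅙ℤ`) of the crux `BetaLinearSector` (route FermatIsogeny) needs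
the CM coincidence `B(1/6,1/2) = √3 · B(1/3,1/2)` realised INSIDE the Kontsevich–Zagier calculus of
moves.  THIS file is the bridge from the elliptic side to the Beta side at the `B(1/3,1/2)` end:
ONE polynomial change of variables (rule (2) of [Kontsevich–Zagier 2001, §1.2]),

* source `A = [(-1,0), 3/√(x³+1)]` (an arc of the CM curve `y² = x³ + 1`);
* map `u = Φ(x) = -x³` from `(-1,0)` onto `(0,1)` (`Φ' = -3x² < 0`, strictly decreasing, the
  inverse branch is `x = -u^{1/3}`);
* target `β = [(0,1), u^{-2/3}(1-u)^{-1/2}]` (value `B(1/3,1/2)`).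

Pull-back check (`cubicArc_pullback`): for `-1 < x < 0`, `(-x³)^{-2/3} = ((-x)³)^{-2/3} = (-x)^{-2}
= 1/x²`, `1 - Φ(x) = 1 + x³ > 0`, so
`β.integrand (Φ x) · |Φ' x| = x^{-2} · (1+x³)^{-1/2} · 3x² = 3/√(x³+1)`, the integrand of `A`
(positivity of the radicand on `(-1, ∞)`: `CertificateDlogUnfolds.cube_add_one_pos`).
Both representations are given (pinned by domain and integrand); only the relation
`[A] − [β] ∈ KZ.relations` is produced, through the one-dimensional packaging
`of_sub_of_mem_changeOfVariablesRel_dimOne` of rule (2) (same architecture as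
`GKZLevelThree.cubicRational_equivalent_beta` and `Quarters.stub_betaFold_duplication`).

References: M. Kontsevich, D. Zagier, *Periods* (2001), §1.2 rule (2); G. E. Andrews, R. Askey,
R. Roy, *Special Functions* (1999), §1.1 (Beta integral).
-/

noncomputable section

namespace Summit.KontsevichZagierPeriods.FermatIsogeny.BetaLinearSector.Sixths

open Set MeasureTheory
open MvPolynomial (aeval X C)
open Literature.NumberTheory.Transcendental Literature.NumberTheory.Transcendental.KZ
open Summit.KontsevichZagierPeriods.HermiteRigidity.CMTwistQuasiPeriodTransfer
  (of_sub_of_mem_changeOfVariablesRel_dimOne)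
open Summit.KontsevichZagierPeriods.KontsevichZagierPeriods.Theorems.GKZLevelThree
  (isSemialgebraicFunOn_ratFun₁)
open Summit.KontsevichZagierPeriods.TorsionLogs.CertificateDlogUnfolds (cube_add_one_pos)

/-! ## The substitution `u = -x³` on `(-1, 0)` -/

/-- The derivative of `Φ(x) = -x³` is `-(3x²)`. -/
theorem cubicArc_hasDerivAt (x : ℝ) :
    HasDerivAt (fun x : ℝ => -x ^ 3) (-(3 * x ^ 2)) x := by
  simpa using (hasDerivAt_pow 3 x).fun_neg

/-- `Φ = -x³` is injective (odd powers are strictly monotone). -/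
theorem cubicArc_inj {p q : ℝ} (h : -p ^ 3 = -q ^ 3) : p = q :=
  (Odd.strictMono_pow (⟨1, by norm_num⟩ : Odd 3)).injective (neg_injective h)

/-- `Φ` maps `(-1, 0)` into `(0, 1)`. -/
theorem cubicArc_mem_Ioo {x : ℝ} (h0 : -1 < x) (h1 : x < 0) : -x ^ 3 ∈ Ioo (0:ℝ) 1 := by
  have hnx : 0 < -x := by linarith
  have hnx1 : -x < 1 := by linarith
  have hcube : -x ^ 3 = (-x) ^ 3 := by ring
  rw [hcube]
  refine ⟨by positivity, ?_⟩
  have h := Odd.strictMono_pow (⟨1, by norm_num⟩ : Odd 3) hnx1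
  simpa using h

/-- `Φ` maps `(-1, 0)` ONTO `(0, 1)`: `u ∈ (0,1)` is `Φ(-u^{1/3})`. -/
theorem cubicArc_image :
    (fun x : ℝ => -x ^ 3) '' {x : ℝ | -1 < x ∧ x < 0} = Ioo 0 1 := by
  apply Subset.antisymm
  · rintro _ ⟨x, hx, rfl⟩
    exact cubicArc_mem_Ioo hx.1 hx.2
  · intro u hu
    have h3 : (3:ℕ) ≠ 0 := by norm_num
    set c : ℝ := u ^ ((3:ℕ)⁻¹ : ℝ) with hc
    have hc3 : c ^ 3 = u := Real.rpow_inv_natCast_pow hu.1.le h3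
    have hc0 : 0 < c := Real.rpow_pos_of_pos hu.1 _
    have hc1 : c < 1 := by
      have hm := Odd.strictMono_pow (⟨1, by norm_num⟩ : Odd 3) (R := ℝ)
      rw [← hm.lt_iff_lt]
      simpa [hc3] using hu.2
    refine ⟨-c, ⟨by linarith, by linarith⟩, ?_⟩
    show -(-c) ^ 3 = u
    rw [← hc3]
    ring

/-! ## The pull-back identity -/

/-- The pull-back identity: for `-1 < x < 0` and `u = -x³`,
`u^{-2/3} (1-u)^{-1/2} · |-(3x²)| = 3/√(x³+1)`. -/
theorem cubicArc_pullback {x : ℝ} (h0 : -1 < x) (h1 : x < 0) :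
    (-x ^ 3) ^ (-(2:ℝ) / 3) * (1 - -x ^ 3) ^ (-(1:ℝ) / 2) * |-(3 * x ^ 2)| =
      3 / Real.sqrt (x ^ 3 + 1) := by
  have hnx : 0 < -x := by linarith
  have hx0 : x ≠ 0 := h1.ne
  have hP : 0 < x ^ 3 + 1 := cube_add_one_pos h0
  have hs : 0 < Real.sqrt (x ^ 3 + 1) := Real.sqrt_pos.2 hP
  -- `(-x³)^{-2/3} = ((-x)³)^{-2/3} = (-x)^{-2} = (x²)⁻¹`
  have hA : (-x ^ 3) ^ (-(2:ℝ) / 3) = (x ^ 2)⁻¹ := by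
    rw [show (-x ^ 3 : ℝ) = (-x) ^ 3 by ring, show ((-x) ^ 3 : ℝ) = (-x) ^ (3:ℝ) by norm_cast,
      ← Real.rpow_mul hnx.le, show ((3:ℝ) * (-(2:ℝ) / 3) : ℝ) = -2 by norm_num,
      Real.rpow_neg hnx.le, Real.rpow_two, neg_sq]
  -- `(1 - (-x³))^{-1/2} = (x³+1)^{-1/2} = (√(x³+1))⁻¹`
  have hB : (1 - -x ^ 3) ^ (-(1:ℝ) / 2) = (Real.sqrt (x ^ 3 + 1))⁻¹ := by
    rw [show (1 - -x ^ 3 : ℝ) = x ^ 3 + 1 by ring, Real.sqrt_eq_rpow, ← Real.rpow_neg hP.le,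
      neg_div]
  have habs : |-(3 * x ^ 2)| = 3 * x ^ 2 := by
    rw [abs_neg]
    exact abs_of_nonneg (by positivity)
  rw [hA, hB, habs]
  field_simp

/-! ## The bridge `[(-1,0), 3/√(x³+1)] ∼ [(0,1), u^{-2/3}(1-u)^{-1/2}]` -/

/-- **The arc `(-1,0)` of `y² = x³+1` is the Beta cell `B(1/3,1/2)`, as ONE change of variables.**
`[(-1,0), 3/√(x³+1)] ∼ [(0,1), u^{-2/3}(1-u)^{-1/2}]` by rule (2) of the Kontsevich–Zagier calculus
along `u = -x³`: `ℚ`-polynomial, injective on `(-1,0)` with image `(0,1)`, derivative `-3x²`, and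
the pull-back identity `cubicArc_pullback`. [cite: KontsevichZagier2001, §1.2 rule (2)] -/
theorem stub_cubicArc_equivalent_thirdBeta : ∀ (A β : KZ.IntegralRep 1), A.domain = {x | -1 < x 0 ∧ x 0 < 0} → Set.EqOn A.integrand (fun x => 3 / Real.sqrt (x 0 ^ 3 + 1)) A.domain → β.domain = {x | x 0 ∈ Set.Ioo (0:ℝ) 1} → Set.EqOn β.integrand (fun x => (x 0) ^ (-(2:ℝ) / 3) * (1 - x 0) ^ (-(1:ℝ) / 2)) β.domain → KZ.Equivalent A β := by
  intro A β hAd hAi hβd hβi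
  set φ : ℝ → ℝ := fun x => -x ^ 3 with hφ
  set φ' : ℝ → ℝ := fun x => -(3 * x ^ 2) with hφ'
  refine changeOfVariablesRel_subset_relations
    (of_sub_of_mem_changeOfVariablesRel_dimOne A β φ φ' ?_ (fun p _ => cubicArc_hasDerivAt (p 0))
      ?_ ?_ ?_)
  · -- `Φ` is a `ℚ`-polynomial, hence `ℚ`-semialgebraic on the domain
    refine isSemialgebraicFunOn_ratFun₁ A.isSemialgebraic_domain (-(X 0 ^ 3)) 1 φ
      (fun x _ => by simp) (fun x _ => ?_)
    simp [hφ]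
  · -- injectivity
    intro p _ q _ hpq
    exact cubicArc_inj hpq
  · -- the image is `(0, 1)`
    rw [hβd, hAd]
    ext y
    simp only [mem_setOf_eq, mem_image]
    constructor
    · intro hy
      have : y 0 ∈ φ '' {x : ℝ | -1 < x ∧ x < 0} := by rw [cubicArc_image]; exact hy
      obtain ⟨w, hw, hwy⟩ := this
      exact ⟨fun _ => w, hw, funext fun i => by rw [Subsingleton.elim i 0]; exact hwy⟩
    · rintro ⟨p, hp, rfl⟩
      exact cubicArc_mem_Ioo hp.1 hp.2
  · -- the pull-back identity on the domain
    intro p hp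
    have hp' : -1 < p 0 ∧ p 0 < 0 := by rw [hAd] at hp; exact hp
    have hφp : (fun _ : Fin 1 => φ (p 0)) ∈ β.domain := by
      rw [hβd]
      exact cubicArc_mem_Ioo hp'.1 hp'.2
    rw [hAi hp, hβi hφp]
    exact (cubicArc_pullback hp'.1 hp'.2).symm

end Summit.KontsevichZagierPeriods.FermatIsogeny.BetaLinearSector.Sixths

end
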